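import Mathlib
import HarnessLib
import Summits.HubbardSuperconductivity.HubbardSuperconductivity.Theorems.KLProgrammeKLRegimeEngineTowerRemeasureTreeWt

/-!
# Route `KLProgramme` — crux K3 ENGINE (stmt-HubbardSuperconductivity-20437 `KLRegimeEngineV17F2`), stub (b) v2 / stub (C) (C2), located risk #17 «(C2)-MOMENTS» (R85a)(B):
# THE DEGREE-`d` CARRIERS — the tree weight `klScaleWtPow … j d = (1 + Λ_j·diam)^d` and the rate-decoupled degree-`d` weighted pinned sum `klWtPinnedSumPow`
# (plan g21 (R85a)(1) «(iii): a degree-j twin of klScaleWt/klWtPinnedSumAt, S-size»; cell gate-hubbard-kl, seat hubbard-kl-k3c2-p3 g10 — PRE-STAGED for the #17 export-twin text)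

The (C2) branch of stub (C) reads momentum derivatives of order ≤ 5 of the two-leg function at `Kₙ`, i.e. (p1b's bridge …TwoLegMomentsFromPosition) spatial
moments of order ≤ 5 of the two-leg kernel; every v2 weighted export is degree 1 (`klScaleWt = 1 + Λ·diam`).  The export twin elected in (R85a)(B) runs the
weight-GENERIC machinery (`treeWtPinnedSum_jump_le_split_of_consts`, the `IsTreeWeight`-generic block doors) with the degree-5 diameter weight.  This file names the
carriers so that the export conjunct and the history binder can be ONE line each:

* §1 **`klScaleWtPow L M β j d S := (1 + Λ_j·diam_d(S))^d`** (`diamWeight (s ↦ (1 + klScale klE0 j · s)^d) (gridLabelDist L (2·(2M)) β)`); `klScaleWtPow_apply`,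
  `klScaleWtPow_one` (`= klScaleWt`), `isTreeWeight_klScaleWtPow` (`isTreeWeight_diamWeight_pow`), `one_le_klScaleWtPow`, `klScaleWtPow_le_of_le` (antitone in the
  rate index), `klScaleWt_pow_eq` (`klScaleWt^d = klScaleWtPow d`);
* §2 **`klWtPinnedSumPow L M β μ K J j d m T q w`** — family `F_J`, weight `klScaleWtPow … j d`, leg `q` pinned at `w`; `klWtPinnedSumPow_one` (`= klWtPinnedSumAt`),
  `_nonneg`, `_sum_le`, `_add_le`, `_anti_rate`, and `_succ` (the `ε`-power written as `m` in degree `m + 1` — the literal left side of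
  `treeWtPinnedSum_jump_le_split_of_consts` with `wt := klScaleWtPow … j d`).
Definitions with bodies + `rfl`/order rows; nothing about the model is asserted; nothing asserts superconductivity.
References: BGM 2006 §2.8 (2.76)–(2.77), §3 (3.5)–(3.6) [cite: BenfattoGiulianiMastropietro2006].
-/

noncomputable section

namespace Summit.HubbardSuperconductivity.HubbardSuperconductivity.Theorems.EngineV8

set_option linter.dupNamespace false -- summit = problem name (single-conjunct summit), D-0017

open Real Finset Literature.MathematicalPhysics.QuantumLattice Literature.Probability.LatticeModels
open Literature.Probability.LatticeModels.BattleFederbush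
open Literature.MathematicalPhysics.QuantumLattice.GrassmannAlgebra
open Summit.HubbardSuperconductivity.HubbardSuperconductivity.Theorems.KLRegimeSplit
open Summit.HubbardSuperconductivity.HubbardSuperconductivity.Theorems.KLProgrammeLegKernels
open Summit.HubbardSuperconductivity.HubbardSuperconductivity.Theorems.DispersionFlow

/-! ## §1 The degree-`d` scale tree weight -/

/-- **The degree-`d` scale-`j` tree weight** on the position sets of the `4M`-grid bookkeeping: `klScaleWtPow L M β j d S = (1 + Λ_j · diam_d(S))^d`
(`d = 1` is `klScaleWt`, `d = 5` the weight of the order-≤ 5 two-leg moment export of located risk #17). -/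
def klScaleWtPow (L M : ℕ) (β : ℝ) (j d : ℕ) (S : Finset (ZMod (2 * (2 * M)) × TorusSite 2 L)) : ℝ :=
  diamWeight (fun s => (1 + klScale klE0 j * s) ^ d) (gridLabelDist L (2 * (2 * M)) β) S

/-- Unfolding `klScaleWtPow`. -/
theorem klScaleWtPow_apply (L M : ℕ) (β : ℝ) (j d : ℕ) (S : Finset (ZMod (2 * (2 * M)) × TorusSite 2 L)) :
    klScaleWtPow L M β j d S = (1 + klScale klE0 j * labelDiam (gridLabelDist L (2 * (2 * M)) β) S) ^ d := rfl

/-- `klScaleWtPow … j d = (klScaleWt … j)^d`. -/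
theorem klScaleWt_pow_eq (L M : ℕ) (β : ℝ) (j d : ℕ) (S : Finset (ZMod (2 * (2 * M)) × TorusSite 2 L)) :
    klScaleWt L M β j S ^ d = klScaleWtPow L M β j d S := by
  rw [klScaleWt_apply, klScaleWtPow_apply]

/-- Degree one is `klScaleWt`. -/
theorem klScaleWtPow_one (L M : ℕ) (β : ℝ) (j : ℕ) (S : Finset (ZMod (2 * (2 * M)) × TorusSite 2 L)) :
    klScaleWtPow L M β j 1 S = klScaleWt L M β j S := by
  rw [← klScaleWt_pow_eq, pow_one]

/-- **`klScaleWtPow` is a tree weight** (`β ≥ 0`). -/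
theorem isTreeWeight_klScaleWtPow (L M : ℕ) [NeZero L] [NeZero M] {β : ℝ} (hβ : 0 ≤ β) (j d : ℕ) : IsTreeWeight (klScaleWtPow L M β j d) :=
  isTreeWeight_diamWeight_pow hβ (klth_klScale_pos j).le d

/-- `1 ≤ klScaleWtPow`. -/
theorem one_le_klScaleWtPow (L M : ℕ) (β : ℝ) (j d : ℕ) (S : Finset (ZMod (2 * (2 * M)) × TorusSite 2 L)) : 1 ≤ klScaleWtPow L M β j d S := by
  rw [← klScaleWt_pow_eq]
  exact one_le_pow₀ (one_le_klScaleWt L M β j S)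

/-- **Antitone in the rate index**: `a ≤ b ⇒ klScaleWtPow … b d ≤ klScaleWtPow … a d`. -/
theorem klScaleWtPow_le_of_le (L M : ℕ) (β : ℝ) {a b : ℕ} (hab : a ≤ b) (d : ℕ) (S : Finset (ZMod (2 * (2 * M)) × TorusSite 2 L)) :
    klScaleWtPow L M β b d S ≤ klScaleWtPow L M β a d S := by
  rw [← klScaleWt_pow_eq, ← klScaleWt_pow_eq]
  exact pow_le_pow_left₀ (zero_le_one.trans (one_le_klScaleWt L M β b S)) (klScaleWt_le_of_le β hab S) d

/-! ## §2 The degree-`d` rate-decoupled weighted pinned sum -/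

variable (L M : ℕ) [NeZero L]

/-- **`klWtPinnedSumPow L M β μ K J j d m T q w`** — the weighted pinned sum of the degree-`m` kernel of `map (toLin' E(F_J)) T` (`F_J = klAnisoFamily … K klE0 J`),
leg `q` pinned at `w`, with the DEGREE-`d` tree weight `klScaleWtPow L M β j d` of rate index `j`. -/
def klWtPinnedSumPow (β μ : ℝ) (K : TrigPolyC4v) (J j d m : ℕ) (T : HubbardGrassmann L M) (q : Fin m)
    (w : SpaceTimeIdx L M × SectorLeg (sectorCount J)) : ℝ :=
  imagTimeWeight β M ^ (m - 1) *
    ∑ X ∈ univ.filter (fun X : Fin m → SpaceTimeIdx L M × SectorLeg (sectorCount J) => X q = w),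
      klScaleWtPow L M β j d ((univ.image X).image (latticeLegPos (2 * (2 * M)))) *
        ‖kernel ℂ (ExteriorAlgebra.map (Matrix.toLin' (sectorAnalysisMatrix L M β (klAnisoFamily L M β μ K klE0 J))) T) m X‖

variable {L M}

/-- Degree one is `klWtPinnedSumAt`. -/
theorem klWtPinnedSumPow_one (β μ : ℝ) (K : TrigPolyC4v) (J j m : ℕ) (T : HubbardGrassmann L M) (q : Fin m)
    (w : SpaceTimeIdx L M × SectorLeg (sectorCount J)) :
    klWtPinnedSumPow L M β μ K J j 1 m T q w = klWtPinnedSumAt L M β μ K J j m T q w := by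
  unfold klWtPinnedSumPow klWtPinnedSumAt
  simp only [klScaleWtPow_one]

/-- The degree-`d` sum in degree `m + 1`, with the `ε`-power written as `m` (`rfl`) — the left side of `treeWtPinnedSum_jump_le_split_of_consts` at `wt := klScaleWtPow … j d`. -/
theorem klWtPinnedSumPow_succ (β μ : ℝ) (K : TrigPolyC4v) (J j d m : ℕ) (T : HubbardGrassmann L M) (q : Fin (m + 1))
    (w : SpaceTimeIdx L M × SectorLeg (sectorCount J)) :
    klWtPinnedSumPow L M β μ K J j d (m + 1) T q w = imagTimeWeight β M ^ m *
      ∑ X ∈ univ.filter (fun X : Fin (m + 1) → SpaceTimeIdx L M × SectorLeg (sectorCount J) => X q = w),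
        klScaleWtPow L M β j d ((univ.image X).image (latticeLegPos (2 * (2 * M)))) *
          ‖kernel ℂ (ExteriorAlgebra.map (Matrix.toLin' (sectorAnalysisMatrix L M β (klAnisoFamily L M β μ K klE0 J))) T) (m + 1) X‖ := rfl

/-- Nonnegativity (`0 ≤ β`). -/
theorem klWtPinnedSumPow_nonneg {β : ℝ} (hβ : 0 ≤ β) (μ : ℝ) (K : TrigPolyC4v) (J j d m : ℕ) (T : HubbardGrassmann L M) (q : Fin m)
    (w : SpaceTimeIdx L M × SectorLeg (sectorCount J)) : 0 ≤ klWtPinnedSumPow L M β μ K J j d m T q w :=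
  mul_nonneg (pow_nonneg (imagTimeWeight_nonneg hβ M) _)
    (sum_nonneg fun _ _ => mul_nonneg (zero_le_one.trans (one_le_klScaleWtPow L M β j d _)) (norm_nonneg _))

/-- **Subadditivity**: the degree-`d` sum of a finite sum of Grassmann elements is at most the sum of theirs. -/
theorem klWtPinnedSumPow_sum_le {β : ℝ} (hβ : 0 ≤ β) (μ : ℝ) (K : TrigPolyC4v) (J j d m : ℕ) {ι : Type*} (s : Finset ι)
    (T : ι → HubbardGrassmann L M) (q : Fin m) (w : SpaceTimeIdx L M × SectorLeg (sectorCount J)) :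
    klWtPinnedSumPow L M β μ K J j d m (∑ i ∈ s, T i) q w ≤ ∑ i ∈ s, klWtPinnedSumPow L M β μ K J j d m (T i) q w := by
  unfold klWtPinnedSumPow
  rw [← mul_sum, sum_comm]
  refine mul_le_mul_of_nonneg_left (sum_le_sum fun X _ => ?_) (pow_nonneg (imagTimeWeight_nonneg hβ M) _)
  rw [← mul_sum]
  refine mul_le_mul_of_nonneg_left ?_ (zero_le_one.trans (one_le_klScaleWtPow L M β j d _))
  rw [map_sum, kernel_sum]
  exact norm_sum_le _ _

/-- Two summands. -/
theorem klWtPinnedSumPow_add_le {β : ℝ} (hβ : 0 ≤ β) (μ : ℝ) (K : TrigPolyC4v) (J j d m : ℕ) (A B : HubbardGrassmann L M) (q : Fin m)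
    (w : SpaceTimeIdx L M × SectorLeg (sectorCount J)) :
    klWtPinnedSumPow L M β μ K J j d m (A + B) q w ≤ klWtPinnedSumPow L M β μ K J j d m A q w + klWtPinnedSumPow L M β μ K J j d m B q w := by
  have h := klWtPinnedSumPow_sum_le hβ μ K J j d m (univ : Finset (Fin 2)) ![A, B] q w
  simpa [Fin.sum_univ_two] using h

/-- **Antitone in the rate index**: `j ≤ j′ ⇒` the rate-`j′` sum is at most the rate-`j` sum. -/
theorem klWtPinnedSumPow_anti_rate {β : ℝ} (hβ : 0 ≤ β) (μ : ℝ) (K : TrigPolyC4v) (J : ℕ) {j j' : ℕ} (hjj : j ≤ j') (d m : ℕ)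
    (T : HubbardGrassmann L M) (q : Fin m) (w : SpaceTimeIdx L M × SectorLeg (sectorCount J)) :
    klWtPinnedSumPow L M β μ K J j' d m T q w ≤ klWtPinnedSumPow L M β μ K J j d m T q w := by
  unfold klWtPinnedSumPow
  refine mul_le_mul_of_nonneg_left (sum_le_sum fun X _ => ?_) (pow_nonneg (imagTimeWeight_nonneg hβ M) _)
  exact mul_le_mul_of_nonneg_right (klScaleWtPow_le_of_le L M β hjj d _) (norm_nonneg _)

/-- **Monotone in the degree**: `d ≤ d′ ⇒` the degree-`d` sum is at most the degree-`d′` sum (the weight is `≥ 1`). -/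
theorem klWtPinnedSumPow_mono_degree {β : ℝ} (hβ : 0 ≤ β) (μ : ℝ) (K : TrigPolyC4v) (J j : ℕ) {d d' : ℕ} (hdd : d ≤ d') (m : ℕ)
    (T : HubbardGrassmann L M) (q : Fin m) (w : SpaceTimeIdx L M × SectorLeg (sectorCount J)) :
    klWtPinnedSumPow L M β μ K J j d m T q w ≤ klWtPinnedSumPow L M β μ K J j d' m T q w := by
  unfold klWtPinnedSumPow
  refine mul_le_mul_of_nonneg_left (sum_le_sum fun X _ => ?_) (pow_nonneg (imagTimeWeight_nonneg hβ M) _)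
  refine mul_le_mul_of_nonneg_right ?_ (norm_nonneg _)
  rw [← klScaleWt_pow_eq, ← klScaleWt_pow_eq]
  exact pow_le_pow_right₀ (one_le_klScaleWt L M β j _) hdd

end Summit.HubbardSuperconductivity.HubbardSuperconductivity.Theorems.EngineV8

end
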